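import Summits.CriticalPhenomena.PercolationContinuityZ3.Theorems.PercNearOneGluingNoHeavyLowerTailRankedSelection
import Summits.CriticalPhenomena.PercolationContinuityZ3.Theorems.PercNearOneGluingNoHeavyLowerTailTieLocusCorner
import HarnessLib

/-!
# `NoHeavyLowerTail` (stmt-CriticalPhenomena-4575) — the TWO-COPY EXPANSION: the pattern-lightest bound for every observer
# follows from its symmetrised form for PAIRS OF DETERMINISTIC observers ("Conjecture S", a typed k-uniform target)

Support file (prover `prim-hp-8`, PL programme; `--supports stmt-CriticalPhenomena-4575`).  No definitions, no named facts, no sorries.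

Notation of `…RankedSelection.lean`: relays `A`, observer `o ∉ A`, ranking `r` injective on `A`, selection events `Sel_b`, patterns `π⁰`,
`R_b = {|π(b)| ≤ j}`, `L = {1 ≤ N ≤ j}`.  For two weight functions `v₁, v₂` put
`B(v₁,v₂) := Σ_{b∈A} μ_{v₁}(Sel_b)·μ_{v₂}(R_b) − μ_{v₁}(L)` — so `B(v,v) = Φ_r(v)`, the pattern-lightest functional, and `Φ_r(v) ≥ 0` is the
pattern-lightest bound with selection `r` (⇒ the registered stub's inequality by `CoinReduction.sum_sel_eq_sum_patterns` ⇒ `stub_cumulativeIsolation`).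

* `twoCopy_nonneg` — **corner-pair positivity ⇒ positivity.**  `B` is affine in each non-loop weight at `o` of EACH slot separately
  (one-bond decomposition), hence if `B(v₁,v₂) + B(v₂,v₁) ≥ 0` for all pairs `(v₁,v₂)` that agree with `v` off the pairs at `o` and have all non-loop
  weights at `o` in `{0,1}` ("deterministic observers" = `o` glued to a set `U ⊆ N(o)`), then `Φ_r(v) = B(v,v) ≥ 0`.  This is the tie-locus/corner
  technique applied to the observer's own edges: `Φ_r` is quadratic in each weight at `o`, its two-copy polarisation is multi-affine.
* `patternLightest_stub_of_cornerPairs` — the same conclusion in the shape of the registered stub `stub_patternLightest`, with the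
  `H`-lightness ranking (`CoinReduction.exists_compatible_ranking`).
* `noHeavyLowerTail_of_conjS` — **typed target:** CONJECTURE S (corner-pair positivity for every graph, relay set, observer and level, with an
  `H`-compatible ranking) implies `NoHeavyLowerTail`, through `PatternLightest.noHeavyLowerTail_of_patternLightest`.
  In set language Conjecture S reads: for all vertex sets `U, V`:  `F(U,V) + F(V,U) ≥ 0`,
  `F(U,V) = Σ_b P_H(β_H(π⁰(U)) = b)·S^{H/V}_b − P_H(1 ≤ |π(U)| ≤ j)` (memo PROOF-COIN-REDUCTION.md §7; 0 violations in ≈ 30 000 exact pairs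
  + 912 adversarial climbs [kit j063400: 0 / 208 718 pairs + 85 929 diagonals]; the diagonal `U = V` is PL for a glued observer; `|U| = |V| = 1` is PL-max for single vertices; the non-symmetrised
  `F(U,V) ≥ 0` is FALSE in ≈ 40 % of cases).
-/

noncomputable section

namespace Summit.CriticalPhenomena.PercolationContinuityZ3.Theorems

namespace CoinReduction

open MeasureTheory Set Literature.Probability.LatticeModels Literature.Probability.Percolation
open scoped Classical BigOperators

variable {n : ℕ}

/-- **Two-copy expansion: corner-pair positivity implies positivity of the pattern-lightest functional.**  If
`B(v₁,v₂) + B(v₂,v₁) ≥ 0` for all `v₁, v₂` agreeing with `v` off the pairs at `o` and with all non-loop weights at `o` in `{0,1}`, then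
`B(v,v) ≥ 0`, i.e. `μ_v(1 ≤ N ≤ j) ≤ Σ_{b∈A} μ_v(Sel_b)·μ_v(R_b)`.  (`B` is affine in each weight at `o` of each slot: induction on the number of
fractional weights.) [folklore] -/
theorem twoCopy_nonneg (v : Sym2 (Fin n) → unitInterval) (A : Finset (Fin n)) (j : ℕ) (o : Fin n) (r : Fin n → ℕ)
    (hS : ∀ v₁ v₂ : Sym2 (Fin n) → unitInterval,
      (∀ e : Sym2 (Fin n), o ∉ e → v₁ e = v e ∧ v₂ e = v e) →
      (∀ y : Fin n, y ≠ o → (v₁ s(o, y) = 0 ∨ v₁ s(o, y) = 1) ∧ (v₂ s(o, y) = 0 ∨ v₂ s(o, y) = 1)) →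
      0 ≤ (∑ b ∈ A, (prodBernoulli v₁).real {ω : BondConfig (Fin n) |
              b ∈ (A.filter fun b' => ω ∈ openConnIn ((↑A : Set (Fin n))ᶜ ∪ {b'}) o b') ∧
              ∀ b' ∈ A, r b' < r b → b' ∉ (A.filter fun b'' => ω ∈ openConnIn ((↑A : Set (Fin n))ᶜ ∪ {b''}) o b'')} *
            (prodBernoulli v₂).real {ω : BondConfig (Fin n) | (A.filter fun z => ω ∈ openConn b z).card ≤ j} -
          (prodBernoulli v₁).real {ω : BondConfig (Fin n) | 1 ≤ (A.filter fun z => ω ∈ openConn o z).card ∧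
            (A.filter fun z => ω ∈ openConn o z).card ≤ j}) +
        (∑ b ∈ A, (prodBernoulli v₂).real {ω : BondConfig (Fin n) |
              b ∈ (A.filter fun b' => ω ∈ openConnIn ((↑A : Set (Fin n))ᶜ ∪ {b'}) o b') ∧
              ∀ b' ∈ A, r b' < r b → b' ∉ (A.filter fun b'' => ω ∈ openConnIn ((↑A : Set (Fin n))ᶜ ∪ {b''}) o b'')} *
            (prodBernoulli v₁).real {ω : BondConfig (Fin n) | (A.filter fun z => ω ∈ openConn b z).card ≤ j} -
          (prodBernoulli v₂).real {ω : BondConfig (Fin n) | 1 ≤ (A.filter fun z => ω ∈ openConn o z).card ∧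
            (A.filter fun z => ω ∈ openConn o z).card ≤ j})) :
    (prodBernoulli v).real {ω : BondConfig (Fin n) | 1 ≤ (A.filter fun z => ω ∈ openConn o z).card ∧
        (A.filter fun z => ω ∈ openConn o z).card ≤ j} ≤
      ∑ b ∈ A, (prodBernoulli v).real {ω : BondConfig (Fin n) |
          b ∈ (A.filter fun b' => ω ∈ openConnIn ((↑A : Set (Fin n))ᶜ ∪ {b'}) o b') ∧
          ∀ b' ∈ A, r b' < r b → b' ∉ (A.filter fun b'' => ω ∈ openConnIn ((↑A : Set (Fin n))ᶜ ∪ {b''}) o b'')} *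
        (prodBernoulli v).real {ω : BondConfig (Fin n) | (A.filter fun z => ω ∈ openConn b z).card ≤ j} := by
  set Sel : Fin n → Set (BondConfig (Fin n)) := fun b => {ω |
    b ∈ (A.filter fun b' => ω ∈ openConnIn ((↑A : Set (Fin n))ᶜ ∪ {b'}) o b') ∧
    ∀ b' ∈ A, r b' < r b → b' ∉ (A.filter fun b'' => ω ∈ openConnIn ((↑A : Set (Fin n))ᶜ ∪ {b''}) o b'')} with hSel
  set R : Fin n → Set (BondConfig (Fin n)) := fun b => {ω | (A.filter fun z => ω ∈ openConn b z).card ≤ j} with hR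
  set L : Set (BondConfig (Fin n)) := {ω | 1 ≤ (A.filter fun z => ω ∈ openConn o z).card ∧
    (A.filter fun z => ω ∈ openConn o z).card ≤ j} with hL
  -- the two-slot functional and its symmetrisation
  set B : (Sym2 (Fin n) → unitInterval) → (Sym2 (Fin n) → unitInterval) → ℝ := fun v₁ v₂ =>
    ∑ b ∈ A, (prodBernoulli v₁).real (Sel b) * (prodBernoulli v₂).real (R b) - (prodBernoulli v₁).real L with hB
  -- number of fractional non-loop weights at o
  set frac : (Sym2 (Fin n) → unitInterval) → ℕ := fun w =>
    (Finset.univ.filter fun y : Fin n => y ≠ o ∧ w s(o, y) ≠ 0 ∧ w s(o, y) ≠ 1).card with hfrac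
  -- claim: B(v₁,v₂) + B(v₂,v₁) ≥ 0 for all pairs agreeing with v off o
  suffices H : ∀ (k : ℕ) (v₁ v₂ : Sym2 (Fin n) → unitInterval), frac v₁ + frac v₂ = k →
      (∀ e : Sym2 (Fin n), o ∉ e → v₁ e = v e ∧ v₂ e = v e) → 0 ≤ B v₁ v₂ + B v₂ v₁ by
    have h := H _ v v rfl (fun e _ => ⟨rfl, rfl⟩)
    change (prodBernoulli v).real L ≤ ∑ b ∈ A, (prodBernoulli v).real (Sel b) * (prodBernoulli v).real (R b)
    have hB' : B v v = ∑ b ∈ A, (prodBernoulli v).real (Sel b) * (prodBernoulli v).real (R b) - (prodBernoulli v).real L := rfl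
    linarith
  -- affinity of B in each slot
  have haff1 : ∀ (w₁ w₂ : Sym2 (Fin n) → unitInterval) (f : Sym2 (Fin n)),
      B w₁ w₂ = (1 - (w₁ f : ℝ)) * B (Function.update w₁ f 0) w₂ + (w₁ f : ℝ) * B (Function.update w₁ f 1) w₂ := by
    intro w₁ w₂ f
    simp only [hB]
    rw [TieLocus.real_oneBond w₁ f L]
    have hs : ∀ b ∈ A, (prodBernoulli w₁).real (Sel b) * (prodBernoulli w₂).real (R b) =
        (1 - (w₁ f : ℝ)) * ((prodBernoulli (Function.update w₁ f 0)).real (Sel b) * (prodBernoulli w₂).real (R b)) +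
          (w₁ f : ℝ) * ((prodBernoulli (Function.update w₁ f 1)).real (Sel b) * (prodBernoulli w₂).real (R b)) := by
      intro b _; rw [TieLocus.real_oneBond w₁ f (Sel b)]; ring
    rw [Finset.sum_congr rfl hs, Finset.sum_add_distrib, ← Finset.mul_sum, ← Finset.mul_sum]
    ring
  have haff2 : ∀ (w₁ w₂ : Sym2 (Fin n) → unitInterval) (f : Sym2 (Fin n)),
      B w₁ w₂ = (1 - (w₂ f : ℝ)) * B w₁ (Function.update w₂ f 0) + (w₂ f : ℝ) * B w₁ (Function.update w₂ f 1) := by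
    intro w₁ w₂ f
    simp only [hB]
    have hs : ∀ b ∈ A, (prodBernoulli w₁).real (Sel b) * (prodBernoulli w₂).real (R b) =
        (1 - (w₂ f : ℝ)) * ((prodBernoulli w₁).real (Sel b) * (prodBernoulli (Function.update w₂ f 0)).real (R b)) +
          (w₂ f : ℝ) * ((prodBernoulli w₁).real (Sel b) * (prodBernoulli (Function.update w₂ f 1)).real (R b)) := by
      intro b _; rw [TieLocus.real_oneBond w₂ f (R b)]; ring
    rw [Finset.sum_congr rfl hs, Finset.sum_add_distrib, ← Finset.mul_sum, ← Finset.mul_sum]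
    ring
  -- pushing one fractional weight of w to 0/1 lowers frac
  have hcount : ∀ (w : Sym2 (Fin n) → unitInterval) (y : Fin n), y ≠ o → w s(o, y) ≠ 0 → w s(o, y) ≠ 1 →
      ∀ t : unitInterval, (t = 0 ∨ t = 1) → frac (Function.update w s(o, y) t) < frac w := by
    intro w y hyo hy0 hy1 t ht
    apply Finset.card_lt_card
    rw [Finset.ssubset_iff_of_subset]
    · refine ⟨y, Finset.mem_filter.2 ⟨Finset.mem_univ _, hyo, hy0, hy1⟩, ?_⟩
      intro h
      have h' := (Finset.mem_filter.1 h).2.2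
      rw [Function.update_self] at h'
      rcases ht with ht | ht
      · exact h'.1 ht
      · exact h'.2 ht
    · intro z hz
      have hz' := (Finset.mem_filter.1 hz).2
      refine Finset.mem_filter.2 ⟨Finset.mem_univ _, hz'.1, ?_⟩
      by_cases hzf : s(o, z) = s(o, y)
      · rw [hzf, Function.update_self] at hz'
        rcases ht with ht | ht
        · exact absurd ht hz'.2.1
        · exact absurd ht hz'.2.2
      · have h2 := hz'.2
        rwa [Function.update_of_ne hzf] at h2
  have hagree : ∀ (w : Sym2 (Fin n) → unitInterval) (y : Fin n) (t : unitInterval),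
      (∀ e : Sym2 (Fin n), o ∉ e → w e = v e) → ∀ e : Sym2 (Fin n), o ∉ e → Function.update w s(o, y) t e = v e := by
    intro w y t hw e he
    have hne : e ≠ s(o, y) := fun h => he (h ▸ Sym2.mem_mk_left o y)
    rw [Function.update_of_ne hne]; exact hw e he
  intro k
  induction k using Nat.strong_induction_on with
  | _ k ih =>
  intro v₁ v₂ hk hag
  by_cases h1 : ∃ y : Fin n, y ≠ o ∧ v₁ s(o, y) ≠ 0 ∧ v₁ s(o, y) ≠ 1
  · obtain ⟨y, hyo, hy0, hy1⟩ := h1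
    set f : Sym2 (Fin n) := s(o, y) with hf
    have e1 := haff1 v₁ v₂ f
    have e2 := haff2 v₂ v₁ f
    have ih0 := ih _ (by rw [← hk]; exact Nat.add_lt_add_right (hcount v₁ y hyo hy0 hy1 0 (Or.inl rfl)) _)
      (Function.update v₁ f 0) v₂ rfl (fun e he => ⟨hagree v₁ y 0 (fun e he => (hag e he).1) e he, (hag e he).2⟩)
    have ih1 := ih _ (by rw [← hk]; exact Nat.add_lt_add_right (hcount v₁ y hyo hy0 hy1 1 (Or.inr rfl)) _)
      (Function.update v₁ f 1) v₂ rfl (fun e he => ⟨hagree v₁ y 1 (fun e he => (hag e he).1) e he, (hag e he).2⟩)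
    have hu0 : 0 ≤ (v₁ f : ℝ) := (v₁ f).2.1
    have hu1 : (v₁ f : ℝ) ≤ 1 := (v₁ f).2.2
    rw [e1, e2]
    nlinarith [mul_nonneg (sub_nonneg.2 hu1) ih0, mul_nonneg hu0 ih1]
  by_cases h2 : ∃ y : Fin n, y ≠ o ∧ v₂ s(o, y) ≠ 0 ∧ v₂ s(o, y) ≠ 1
  · obtain ⟨y, hyo, hy0, hy1⟩ := h2
    set f : Sym2 (Fin n) := s(o, y) with hf
    have e1 := haff2 v₁ v₂ f
    have e2 := haff1 v₂ v₁ f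
    have ih0 := ih _ (by rw [← hk]; exact Nat.add_lt_add_left (hcount v₂ y hyo hy0 hy1 0 (Or.inl rfl)) _)
      v₁ (Function.update v₂ f 0) rfl (fun e he => ⟨(hag e he).1, hagree v₂ y 0 (fun e he => (hag e he).2) e he⟩)
    have ih1 := ih _ (by rw [← hk]; exact Nat.add_lt_add_left (hcount v₂ y hyo hy0 hy1 1 (Or.inr rfl)) _)
      v₁ (Function.update v₂ f 1) rfl (fun e he => ⟨(hag e he).1, hagree v₂ y 1 (fun e he => (hag e he).2) e he⟩)
    have hu0 : 0 ≤ (v₂ f : ℝ) := (v₂ f).2.1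
    have hu1 : (v₂ f : ℝ) ≤ 1 := (v₂ f).2.2
    rw [e1, e2]
    nlinarith [mul_nonneg (sub_nonneg.2 hu1) ih0, mul_nonneg hu0 ih1]
  -- both slots deterministic at o: the corner-pair hypothesis
  push Not at h1 h2
  have hdet : ∀ y : Fin n, y ≠ o → (v₁ s(o, y) = 0 ∨ v₁ s(o, y) = 1) ∧ (v₂ s(o, y) = 0 ∨ v₂ s(o, y) = 1) := by
    intro y hyo
    refine ⟨?_, ?_⟩
    · by_cases h : v₁ s(o, y) = 0
      · exact Or.inl h
      · exact Or.inr (h1 y hyo h)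
    · by_cases h : v₂ s(o, y) = 0
      · exact Or.inl h
      · exact Or.inr (h2 y hyo h)
  exact hS v₁ v₂ hag hdet

/-- **Conjecture S (corner-pair positivity) in the shape of the registered stub.**  If for the weighted graph `w`, relays `A`, observer
`o ∉ A`, level `j` and an `H`-compatible injective ranking `r` the symmetrised two-copy functional is nonnegative at every pair of
deterministic observers, then the inequality of `stub_patternLightest` holds at `(w, A, o, j)`. [folklore — `twoCopy_nonneg` +
`CoinReduction.sum_sel_eq_sum_patterns`] -/
theorem patternLightest_stub_of_cornerPairs (v : Sym2 (Fin n) → unitInterval) (A : Finset (Fin n)) (o : Fin n) (j : ℕ)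
    (r : Fin n → ℕ) (hr : Set.InjOn r ↑A)
    (hS : ∀ v₁ v₂ : Sym2 (Fin n) → unitInterval,
      (∀ e : Sym2 (Fin n), o ∉ e → v₁ e = v e ∧ v₂ e = v e) →
      (∀ y : Fin n, y ≠ o → (v₁ s(o, y) = 0 ∨ v₁ s(o, y) = 1) ∧ (v₂ s(o, y) = 0 ∨ v₂ s(o, y) = 1)) →
      0 ≤ (∑ b ∈ A, (prodBernoulli v₁).real {ω : BondConfig (Fin n) |
              b ∈ (A.filter fun b' => ω ∈ openConnIn ((↑A : Set (Fin n))ᶜ ∪ {b'}) o b') ∧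
              ∀ b' ∈ A, r b' < r b → b' ∉ (A.filter fun b'' => ω ∈ openConnIn ((↑A : Set (Fin n))ᶜ ∪ {b''}) o b'')} *
            (prodBernoulli v₂).real {ω : BondConfig (Fin n) | (A.filter fun z => ω ∈ openConn b z).card ≤ j} -
          (prodBernoulli v₁).real {ω : BondConfig (Fin n) | 1 ≤ (A.filter fun z => ω ∈ openConn o z).card ∧
            (A.filter fun z => ω ∈ openConn o z).card ≤ j}) +
        (∑ b ∈ A, (prodBernoulli v₂).real {ω : BondConfig (Fin n) |
              b ∈ (A.filter fun b' => ω ∈ openConnIn ((↑A : Set (Fin n))ᶜ ∪ {b'}) o b') ∧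
              ∀ b' ∈ A, r b' < r b → b' ∉ (A.filter fun b'' => ω ∈ openConnIn ((↑A : Set (Fin n))ᶜ ∪ {b''}) o b'')} *
            (prodBernoulli v₁).real {ω : BondConfig (Fin n) | (A.filter fun z => ω ∈ openConn b z).card ≤ j} -
          (prodBernoulli v₂).real {ω : BondConfig (Fin n) | 1 ≤ (A.filter fun z => ω ∈ openConn o z).card ∧
            (A.filter fun z => ω ∈ openConn o z).card ≤ j})) :
    ∃ sel : Finset (Fin n) → Fin n, (∀ B ∈ A.powerset.erase ∅, sel B ∈ B) ∧
      (prodBernoulli v).real {ω : BondConfig (Fin n) |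
          1 ≤ (A.filter fun x => ω ∈ openConn o x).card ∧ (A.filter fun x => ω ∈ openConn o x).card ≤ j} ≤
        ∑ B ∈ A.powerset.erase ∅,
          (prodBernoulli v).real {ω : BondConfig (Fin n) |
              (A.filter fun b => ω ∈ openConnIn ((↑A : Set (Fin n))ᶜ ∪ {b}) o b) = B} *
            (prodBernoulli v).real {ω : BondConfig (Fin n) | (A.filter fun x => ω ∈ openConn (sel B) x).card ≤ j} := by
  have hex : ∀ B : Finset (Fin n), B.Nonempty → ∃ b ∈ B, ∀ b' ∈ B, r b ≤ r b' :=
    fun B hB => Finset.exists_min_image B r hB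
  set sel : Finset (Fin n) → Fin n := fun B => if h : B.Nonempty then Classical.choose (hex B h) else o with hseldef
  have hsel : ∀ B : Finset (Fin n), B.Nonempty → sel B ∈ B ∧ ∀ b ∈ B, r (sel B) ≤ r b := by
    intro B hB
    have h := Classical.choose_spec (hex B hB)
    simp only [hseldef, dif_pos hB]
    exact ⟨h.1, h.2⟩
  refine ⟨sel, fun B hB => (hsel B (Finset.nonempty_iff_ne_empty.2 (Finset.ne_of_mem_erase hB))).1, ?_⟩
  have key := sum_sel_eq_sum_patterns (prodBernoulli v) A o r hr sel hsel
    (fun b => (prodBernoulli v).real {ω : BondConfig (Fin n) | (A.filter fun x => ω ∈ openConn b x).card ≤ j})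
  rw [← key]
  exact twoCopy_nonneg v A j o r hS

/-- **Typed target: Conjecture S implies `NoHeavyLowerTail`.**  CONJECTURE S = corner-pair positivity of the symmetrised two-copy
pattern-lightest functional, for every weighted graph on `Fin n`, every relay set `A`, observer `o ∉ A`, level `j`, and every injective
ranking `r` compatible with lightness in `H` (the weights with the pairs at `o` switched off).  It implies the registered `stub_patternLightest`
bound at every instance (`patternLightest_stub_of_cornerPairs` with an `H`-compatible ranking from `exists_compatible_ranking`), hence the
crux by `PatternLightest.noHeavyLowerTail_of_patternLightest`. [folklore — reduction only; Conjecture S is open (memo PROOF-COIN-REDUCTION.md §7)] -/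
theorem noHeavyLowerTail_of_conjS
    (hConjS : ∀ (n : ℕ) (v v₁ v₂ : Sym2 (Fin n) → unitInterval) (A : Finset (Fin n)) (o : Fin n) (j : ℕ) (r : Fin n → ℕ),
      o ∉ A → Set.InjOn r ↑A →
      (∀ b ∈ A, ∀ b' ∈ A, r b < r b' →
        (Literature.Probability.LatticeModels.prodBernoulli fun e : Sym2 (Fin n) =>
            if e ∈ {e : Sym2 (Fin n) | o ∉ e} then v e else 0).real
            {ω : Literature.Probability.Percolation.BondConfig (Fin n) |
              (A.filter fun z => ω ∈ Literature.Probability.Percolation.openConn b' z).card ≤ j} ≤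
          (Literature.Probability.LatticeModels.prodBernoulli fun e : Sym2 (Fin n) =>
            if e ∈ {e : Sym2 (Fin n) | o ∉ e} then v e else 0).real
            {ω : Literature.Probability.Percolation.BondConfig (Fin n) |
              (A.filter fun z => ω ∈ Literature.Probability.Percolation.openConn b z).card ≤ j}) →
      (∀ e : Sym2 (Fin n), o ∉ e → v₁ e = v e ∧ v₂ e = v e) →
      (∀ y : Fin n, y ≠ o → (v₁ s(o, y) = 0 ∨ v₁ s(o, y) = 1) ∧ (v₂ s(o, y) = 0 ∨ v₂ s(o, y) = 1)) →
      0 ≤ (∑ b ∈ A, (Literature.Probability.LatticeModels.prodBernoulli v₁).real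
              {ω : Literature.Probability.Percolation.BondConfig (Fin n) |
                b ∈ (A.filter fun b' => ω ∈ Literature.Probability.Percolation.openConnIn ((↑A : Set (Fin n))ᶜ ∪ {b'}) o b') ∧
                ∀ b' ∈ A, r b' < r b →
                  b' ∉ (A.filter fun b'' => ω ∈ Literature.Probability.Percolation.openConnIn ((↑A : Set (Fin n))ᶜ ∪ {b''}) o b'')} *
            (Literature.Probability.LatticeModels.prodBernoulli v₂).real
              {ω : Literature.Probability.Percolation.BondConfig (Fin n) |
                (A.filter fun z => ω ∈ Literature.Probability.Percolation.openConn b z).card ≤ j} -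
          (Literature.Probability.LatticeModels.prodBernoulli v₁).real
            {ω : Literature.Probability.Percolation.BondConfig (Fin n) |
              1 ≤ (A.filter fun z => ω ∈ Literature.Probability.Percolation.openConn o z).card ∧
              (A.filter fun z => ω ∈ Literature.Probability.Percolation.openConn o z).card ≤ j}) +
        (∑ b ∈ A, (Literature.Probability.LatticeModels.prodBernoulli v₂).real
              {ω : Literature.Probability.Percolation.BondConfig (Fin n) |
                b ∈ (A.filter fun b' => ω ∈ Literature.Probability.Percolation.openConnIn ((↑A : Set (Fin n))ᶜ ∪ {b'}) o b') ∧
                ∀ b' ∈ A, r b' < r b →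
                  b' ∉ (A.filter fun b'' => ω ∈ Literature.Probability.Percolation.openConnIn ((↑A : Set (Fin n))ᶜ ∪ {b''}) o b'')} *
            (Literature.Probability.LatticeModels.prodBernoulli v₁).real
              {ω : Literature.Probability.Percolation.BondConfig (Fin n) |
                (A.filter fun z => ω ∈ Literature.Probability.Percolation.openConn b z).card ≤ j} -
          (Literature.Probability.LatticeModels.prodBernoulli v₂).real
            {ω : Literature.Probability.Percolation.BondConfig (Fin n) |
              1 ≤ (A.filter fun z => ω ∈ Literature.Probability.Percolation.openConn o z).card ∧
              (A.filter fun z => ω ∈ Literature.Probability.Percolation.openConn o z).card ≤ j})) :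
    Summit.CriticalPhenomena.PercolationContinuityZ3.Theses.PercNearOneGluing.NoHeavyLowerTail := by
  apply PatternLightest.noHeavyLowerTail_of_patternLightest
  intro n w A o j hoA
  obtain ⟨r, hr, hcompat⟩ := exists_compatible_ranking
    (fun b => (prodBernoulli fun e : Sym2 (Fin n) => if e ∈ {e : Sym2 (Fin n) | o ∉ e} then w e else 0).real
      {ω : BondConfig (Fin n) | (A.filter fun z => ω ∈ openConn b z).card ≤ j}) A
  exact patternLightest_stub_of_cornerPairs w A o j r hr
    (fun v₁ v₂ hag hdet => hConjS n w v₁ v₂ A o j r hoA hr hcompat hag hdet)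

end CoinReduction

end Summit.CriticalPhenomena.PercolationContinuityZ3.Theorems

end
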